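import Literature.Analysis.FluidPDE.AxisymPoloidalPart
import HarnessLib

/-!
# Purely azimuthal axisymmetric fields `c • e_θ` are divergence free — at every point, junk-robustly

Analysis/FluidPDE support file (theorems only; no new definition). In cylindrical coordinates the
divergence of an axisymmetric field `v = v^r e_r + v^θ e_θ + v³ e₃` is
`div v = r⁻¹ ∂_r(r v^r) + r⁻¹ ∂_θ v^θ + ∂₃ v³` (Majda–Bertozzi 2002, §2.3.3, the incompressibility
display before (2.60), p.57, written for the swirl-free part; the swirl component `v^θ(r, x₃) e_θ`
of (2.63) contributes `r⁻¹∂_θ v^θ = 0`). Hence a purely azimuthal field `u = c e_θ` with an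
axisymmetric amplitude `c = c(r, x₃)` is divergence free off the axis.

This file proves the statement for the tree's pointwise, junk-valued `VectorCalculus.divergence`
(trace of `fderiv`, `0` where the field is not differentiable) at EVERY point of `ℝ³`, with NO
regularity hypothesis on `c`:

* `isDivFree_smul_eTheta` — `IsAxisymmetricScalar c → VectorCalculus.IsDivFree (fun x => c x • eTheta x)`.

Off the axis, where the field is differentiable, this is (4.3) of the poloidal-part calculus
(`divergence_poloidalPart`: the field has zero poloidal part). Where the field is not
differentiable the divergence is the junk value `0`. At a point `y` ON the axis where the field
happens to be differentiable, the three diagonal entries of `Du(y)` vanish for an algebraic reason: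
`u ⊥ e₃` everywhere and `⟪u(x), (x₀, x₁, 0)⟫ = 0` everywhere, so along the lines `y + t eᵢ` the
`i`-th component of `u` vanishes identically (`i = 0, 1, 2`), and so does its derivative.

Filed by the D-0090 NS-CLAIMS cell (salvage seat `ns-claims-salvage-p2`) as the TRUE content of
an adjudicated row's clause (locator, not author): `Literature.Claims.NS.SuZhen2026.Step5c_DivFree`
(C140, §5 p.8 l.153 «divergence-free: ∇·u ≡ 0» for `u = u_θ(r,z) e_θ`), which holds AS TYPED for
every amplitude — so that clause is not where the printed chain breaks.

## References

* A. J. Majda, A. L. Bertozzi, *Vorticity and Incompressible Flow*, CUP 2002, §2.3.3, the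
  incompressibility display before (2.60) (p.57) and (2.63) (p.58). [`MajdaBertozziCUP2002`]

WHAT THIS IS NOT: not a claim about NS regularity or blow-up; not a claim about any author beyond
the typed locator.
-/

noncomputable section

open Set Function Filter InnerProductSpace
open scoped RealInnerProductSpace Topology

namespace Literature.Analysis.FluidPDE

variable {c : EuclideanSpace ℝ (Fin 3) → ℝ}

/-- `R_θ (a • v) = a • R_θ v` (plumbing). [folklore] -/
private theorem rotZ_smul_azi (θ a : ℝ) (v : EuclideanSpace ℝ (Fin 3)) :
    rotZ θ (a • v) = a • rotZ θ v := by
  ext i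
  fin_cases i <;> simp [rotZ] <;> ring

/-- `e_θ (R_θ x) = R_θ e_θ(x)` (plumbing). [folklore] -/
private theorem eTheta_rotZ_azi (θ : ℝ) (x : EuclideanSpace ℝ (Fin 3)) :
    eTheta (rotZ θ x) = rotZ θ (eTheta x) := by
  rw [eTheta, eTheta, cylRadius_rotZ]
  ext i
  fin_cases i <;> simp [rotZ] <;> ring

/-- The poloidal part of `c • e_θ` vanishes identically (off the axis `‖e_θ‖ = 1`, on the axis
`e_θ = 0`). [folklore] -/
private theorem poloidalPart_smul_eTheta (c : EuclideanSpace ℝ (Fin 3) → ℝ) :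
    poloidalPart (fun x => c x • eTheta x) = fun _ => 0 := by
  funext x
  rw [poloidalPart_apply, swirlVelocity, real_inner_smul_left, real_inner_self_eq_norm_sq]
  by_cases hx : cylRadius x = 0
  · simp [eTheta, hx]
  · have h1 : ‖eTheta x‖ = 1 := by
      rw [eTheta, norm_smul, norm_inv, Real.norm_eq_abs, abs_of_nonneg (cylRadius_nonneg x)]
      have : ‖(WithLp.toLp 2 ![-x 1, x 0, 0] : EuclideanSpace ℝ (Fin 3))‖ = cylRadius x := by
        rw [EuclideanSpace.norm_eq, cylRadius]
        congr 1
        simp [Fin.sum_univ_three]; ring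
      rw [this, inv_mul_cancel₀ hx]
    rw [h1]
    simp

/-- Along the coordinate line `y + t eᵢ` through an axis point `y`, the `i`-th component of
`c • e_θ` vanishes identically (for `i = 0, 1` because `⟪e_θ(x), (x₀, x₁, 0)⟫ = 0` and the line has
`(x₀, x₁) = t eᵢ`; for `i = 2` because `e_θ ⊥ e₃`). [folklore] -/
private theorem smul_eTheta_line_apply_eq_zero (c : EuclideanSpace ℝ (Fin 3) → ℝ)
    {y : EuclideanSpace ℝ (Fin 3)} (hy : cylRadius y = 0) (i : Fin 3) (t : ℝ) :
    (c (y + t • EuclideanSpace.single i 1) • eTheta (y + t • EuclideanSpace.single i 1)) i = 0 := by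
  obtain ⟨hy0, hy1⟩ := (cylRadius_eq_zero_iff y).1 hy
  fin_cases i <;> simp [eTheta, hy0, hy1]

/-- At an axis point where `c • e_θ` is differentiable, every diagonal entry of its derivative
vanishes. [folklore] -/
private theorem fderiv_smul_eTheta_apply_diag_eq_zero (c : EuclideanSpace ℝ (Fin 3) → ℝ)
    {y : EuclideanSpace ℝ (Fin 3)} (hy : cylRadius y = 0)
    (hd : DifferentiableAt ℝ (fun x => c x • eTheta x) y) (i : Fin 3) :
    fderiv ℝ (fun x => c x • eTheta x) y (EuclideanSpace.single i 1) i = 0 := by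
  set u : EuclideanSpace ℝ (Fin 3) → EuclideanSpace ℝ (Fin 3) := fun x => c x • eTheta x with hu
  set e : EuclideanSpace ℝ (Fin 3) := EuclideanSpace.single i (1 : ℝ) with he
  -- the line `t ↦ y + t e` and `u` along it
  have hline : HasDerivAt (fun t : ℝ => y + t • e) e 0 := by
    simpa using ((hasDerivAt_id (0 : ℝ)).smul_const e).const_add y
  have h0 : y + (0 : ℝ) • e = y := by simp
  have hcomp : HasDerivAt (fun t : ℝ => u (y + t • e)) (fderiv ℝ u y e) 0 := by
    have h : HasFDerivAt u (fderiv ℝ u y) (y + (0 : ℝ) • e) := by rw [h0]; exact hd.hasFDerivAt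
    have := h.comp_hasDerivAt (0 : ℝ) hline
    simpa [Function.comp_def] using this
  -- the scalar `t ↦ ⟪u (y + t e), e⟫ = (u (y + t e)) i` vanishes identically
  have hinner : HasDerivAt (fun t : ℝ => ⟪u (y + t • e), e⟫) (⟪u (y + (0 : ℝ) • e), (0 : _)⟫ +
      ⟪fderiv ℝ u y e, e⟫) 0 :=
    hcomp.inner ℝ (hasDerivAt_const (0 : ℝ) e)
  have hzero : (fun t : ℝ => ⟪u (y + t • e), e⟫) = fun _ => 0 := by
    funext t
    rw [he, EuclideanSpace.inner_single_right]
    simp [hu, smul_eTheta_line_apply_eq_zero c hy i t]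
  rw [hzero] at hinner
  have huniq := hinner.unique (hasDerivAt_const (0 : ℝ) (0 : ℝ))
  rw [inner_zero_right, zero_add, he, EuclideanSpace.inner_single_right] at huniq
  simpa using huniq

/-- **Purely azimuthal axisymmetric fields are divergence free, at every point.** For any scalar
`c` invariant under rotations about the axis, the field `x ↦ c(x) e_θ(x)` satisfies
`VectorCalculus.IsDivFree` — the tree's pointwise divergence (trace of `fderiv`, junk `0` where not
differentiable) vanishes everywhere: off the axis by the poloidal-part identity (4.3) (the field has
zero poloidal part), on the axis by the vanishing of the diagonal entries of the derivative, and
trivially where the field is not differentiable. (MB 2002 §2.3.3: `div v = r⁻¹∂_r(r v^r) +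
r⁻¹∂_θ v^θ + ∂₃v³`, `= 0` for `v = v^θ(r,x₃) e_θ`.)
[cite: MajdaBertozziCUP2002, §2.3.3 display before (2.60) p.57 and (2.63) p.58] -/
theorem isDivFree_smul_eTheta (hc : IsAxisymmetricScalar c) :
    VectorCalculus.IsDivFree (fun x => c x • eTheta x) := by
  intro y
  by_cases hd : DifferentiableAt ℝ (fun x => c x • eTheta x) y
  swap
  · simp [VectorCalculus.divergence, fderiv_zero_of_not_differentiableAt hd]
  by_cases hy : cylRadius y = 0
  · -- on the axis: all diagonal entries of `Du(y)` vanish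
    rw [divergence_eq_sum_inner_fderiv (EuclideanSpace.basisFun (Fin 3) ℝ)]
    have h0 := fderiv_smul_eTheta_apply_diag_eq_zero c hy hd 0
    have h1 := fderiv_smul_eTheta_apply_diag_eq_zero c hy hd 1
    have h2 := fderiv_smul_eTheta_apply_diag_eq_zero c hy hd 2
    simp [Fin.sum_univ_three, EuclideanSpace.inner_single_left, h0, h1, h2]
  · -- off the axis: zero poloidal part, (4.3)
    have hrot : ∀ θ : ℝ, (fun x => c x • eTheta x) (rotZ θ y) = rotZ θ ((fun x => c x • eTheta x) y) :=
      fun θ => by simp only [hc θ y, eTheta_rotZ_azi, rotZ_smul_azi]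
    rw [← divergence_poloidalPart hd hy hrot, poloidalPart_smul_eTheta]
    simp [VectorCalculus.divergence]

end Literature.Analysis.FluidPDE
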